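import Literature.NumberTheory.Transcendental.ZudilinPhase
import Literature.Analysis.SpecialFunctions.LogNormIntegrals
import Mathlib.Analysis.SpecialFunctions.Trigonometric.DerivHyp
import HarnessLib

/-!
# Crude bounds for Zudilin's phase, its derivative and the amplitude

Topic `Literature/NumberTheory/Transcendental`; continues `ZudilinPhase.lean`
(`Literature.NumberTheory.Transcendental.Zudilin2004.phase`/`dphase`/`amp`/`psiR`). Everything
here is PROVED; no definitions, no named facts.

These are the uniform (in the height `u = im κ`) majorants that make the vertical line
`re κ = x₀` an admissible contour for the Laplace method applied to Zudilin's Barnes integral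
([Zudilin2004, §8 Lemma 20]; cf. [Zudilin2002, §4 Lemmas 3–5] for the shape of such estimates):

* `norm_log_le_of_norm_le` — `‖log z‖ ≤ log M + π` for `1 ≤ ‖z‖ ≤ M`;
* `Zudilin2004.norm_dphase_le` — `‖Φ'(κ)‖ ≤ 32 (log (180 + 2 im κ) + π) + 2π` on the strip
  `22 ≤ re κ ≤ 25`, `im κ > 0`;
* `Zudilin2004.norm_amp_le` — `‖A(κ)‖ ≤ 17 (log (180 + 2 im κ) + π) + |C₂|` there;
* `Zudilin2004.re_psiR_le` — `Re ψ(κ) ≤ C₁ + 162 log (180 + 2 im κ)` there (the denominator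
  blocks only help: `log ‖κ + x‖ ≥ 0` for `x ≥ 2`);
* `Zudilin2004.norm_phase_sub_phase_le` — the horizontal Lipschitz bound
  `‖Φ(x' + iu) − Φ(x + iu)‖ ≤ |x' − x| (32 (log (180 + 2u) + π) + 2π)` for `x, x' ∈ [22, 25]`;
* `Zudilin2004.continuousOn_dphase`, `Zudilin2004.continuousOn_amp` on the open upper half-plane;
* `Zudilin2004.exp_dphase` — `exp Φ'(κ) = κ³(κ+64)³∏(κ+12−u) / ((κ−27)³(κ+37)³∏(κ+25+u))`, the
  exponentiated saddle-point equation of [Zudilin2004, Lemma 20];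
* `sinh_div_cosh_cube_le`, `sinh_div_cosh_cube_eq`, `tendsto_sinh_div_cosh_cube_mul_exp` — the
  kernel `sinh y / cosh³ y = 4e^{−2y}(1 − e^{−2y})/(1 + e^{−2y})³ ≤ 4 e^{−2y}` (`y ≥ 0`) and
  `e^{2y} sinh y / cosh³ y → 4`.

## References

* [Zudilin2004] W. Zudilin, J. Théor. Nombres Bordeaux 16 (2004), §8, Lemma 20.
* [Zudilin2002] W. Zudilin, Izv. Math. 66 (2002), §4, Lemmas 3–5.
-/

noncomputable section

open Complex Finset Filter
open scoped Real Topology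

namespace Literature.NumberTheory.Transcendental

/-! ### `‖log z‖` -/

/-- `‖log z‖ ≤ log M + π` whenever `1 ≤ ‖z‖ ≤ M`. [folklore] -/
theorem norm_log_le_of_norm_le {z : ℂ} {M : ℝ} (h1 : 1 ≤ ‖z‖) (hM : ‖z‖ ≤ M) :
    ‖log z‖ ≤ Real.log M + π := by
  have hz : z ≠ 0 := by
    intro h; rw [h, norm_zero] at h1; exact absurd h1 (by norm_num)
  refine (norm_le_abs_re_add_abs_im _).trans (add_le_add ?_ ?_)
  · rw [Complex.log_re, abs_of_nonneg (Real.log_nonneg h1)]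
    exact Real.log_le_log (by linarith) hM
  · rw [Complex.log_im]; exact abs_arg_le_pi z

namespace Zudilin2004

/-! ### The strip `22 ≤ re κ ≤ 25`, `im κ > 0` -/

/-- On the strip, every `κ + a` with `a ∈ [-27, 64]` and `|re κ + a| ≥ 1` has
`1 ≤ ‖κ + a‖ ≤ 180 + 2 im κ`, hence `‖log (κ + a)‖ ≤ log (180 + 2 im κ) + π`. [folklore] -/
theorem norm_log_add_le {κ : ℂ} (hx : 22 ≤ κ.re) (hx' : κ.re ≤ 25) (hu : 0 < κ.im) {a : ℝ}
    (ha : -27 ≤ a) (ha' : a ≤ 64) (hra : 1 ≤ |κ.re + a|) :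
    ‖log (κ + a)‖ ≤ Real.log (180 + 2 * κ.im) + π := by
  refine norm_log_le_of_norm_le ?_ ?_
  · refine hra.trans ?_
    simpa using abs_re_le_norm (κ + a)
  · refine (norm_le_abs_re_add_abs_im _).trans ?_
    simp only [add_re, ofReal_re, add_im, ofReal_im, add_zero]
    rw [abs_of_pos hu]
    have : |κ.re + a| ≤ 89 := by rw [abs_le]; constructor <;> linarith
    linarith

/-- **`‖Φ'(κ)‖ ≤ 32 (log (180 + 2 im κ) + π) + 2π`** on the strip `22 ≤ re κ ≤ 25`, `im κ > 0`.
[cite: Zudilin2004, §8 Lemma 20] -/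
theorem norm_dphase_le {κ : ℂ} (hx : 22 ≤ κ.re) (hx' : κ.re ≤ 25) (hu : 0 < κ.im) :
    ‖dphase κ‖ ≤ 32 * (Real.log (180 + 2 * κ.im) + π) + 2 * π := by
  set B := Real.log (180 + 2 * κ.im) + π with hB
  have hB0 : 0 ≤ B := by
    have : 0 ≤ Real.log (180 + 2 * κ.im) := Real.log_nonneg (by linarith)
    positivity
  have hL : ∀ a : ℝ, -27 ≤ a → a ≤ 64 → 1 ≤ |κ.re + a| → ‖log (κ + a)‖ ≤ B :=
    fun a ha ha' hra ↦ norm_log_add_le hx hx' hu ha ha' hra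
  have h0 : ‖log κ‖ ≤ B := by
    simpa using hL 0 (by norm_num) (by norm_num) (by rw [abs_of_pos (by linarith)]; linarith)
  have h27 : ‖log (κ - 27)‖ ≤ B := by
    have := hL (-27) (by norm_num) (by norm_num)
      (by rw [abs_of_neg (by linarith)]; linarith)
    simpa [sub_eq_add_neg] using this
  have h64 : ‖log (κ + 64)‖ ≤ B := by
    simpa using hL 64 (by norm_num) (by norm_num) (by rw [abs_of_pos (by linarith)]; linarith)
  have h37 : ‖log (κ + 37)‖ ≤ B := by
    simpa using hL 37 (by norm_num) (by norm_num) (by rw [abs_of_pos (by linarith)]; linarith)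
  have hsum : ‖∑ u ∈ Icc (1 : ℕ) 10, (log (κ + 25 + (u : ℂ)) - log (κ + 12 - (u : ℂ)))‖ ≤ 10 * (2 * B) := by
    refine (norm_sum_le _ _).trans ?_
    have : ∀ u ∈ Icc (1 : ℕ) 10, ‖log (κ + 25 + (u : ℂ)) - log (κ + 12 - (u : ℂ))‖ ≤ 2 * B := by
      intro u hu'
      rw [mem_Icc] at hu'
      have hu1 : (1 : ℝ) ≤ u := by exact_mod_cast hu'.1
      have hu2 : (u : ℝ) ≤ 10 := by exact_mod_cast hu'.2
      have e1 : κ + 25 + (u : ℂ) = κ + ((25 + u : ℝ) : ℂ) := by push_cast; ring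
      have e2 : κ + 12 - (u : ℂ) = κ + ((12 - u : ℝ) : ℂ) := by push_cast; ring
      have i1 := hL (25 + u) (by linarith) (by linarith) (by rw [abs_of_pos (by linarith)]; linarith)
      have i2 := hL (12 - u) (by linarith) (by linarith) (by rw [abs_of_pos (by linarith)]; linarith)
      rw [e1, e2]
      exact (norm_sub_le _ _).trans (by linarith)
    refine (sum_le_sum this).trans ?_
    simp
  have hpi : ‖(2 * Real.pi * I : ℂ)‖ = 2 * π := by
    rw [norm_mul, norm_mul, Complex.norm_I, mul_one, Complex.norm_real, Complex.norm_ofNat,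
      Real.norm_eq_abs, abs_of_pos Real.pi_pos]
  unfold dphase
  have e : ∀ z : ℂ, ‖(3 : ℂ) * z‖ = 3 * ‖z‖ := fun z ↦ by rw [norm_mul, Complex.norm_ofNat]
  calc _ ≤ ‖3 * log κ‖ + ‖3 * log (κ - 27)‖ + ‖3 * log (κ + 64)‖ + ‖3 * log (κ + 37)‖ +
        ‖∑ u ∈ Icc (1 : ℕ) 10, (log (κ + 25 + (u : ℂ)) - log (κ + 12 - (u : ℂ)))‖ +
        ‖(2 * Real.pi * I : ℂ)‖ := by
          refine (norm_add_le _ _).trans (add_le_add ?_ le_rfl)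
          refine (norm_sub_le _ _).trans (add_le_add ?_ le_rfl)
          refine (norm_sub_le _ _).trans (add_le_add ?_ le_rfl)
          refine (norm_add_le _ _).trans (add_le_add ?_ le_rfl)
          exact norm_sub_le _ _
    _ ≤ 3 * B + 3 * B + 3 * B + 3 * B + 10 * (2 * B) + 2 * π := by
          rw [e, e, e, e, hpi]; gcongr
    _ = 32 * B + 2 * π := by ring

/-- **`‖A(κ)‖ ≤ 17 (log (180 + 2 im κ) + π) + |C₂|`** on the strip, `C₂` the real constant of
`Zudilin2004.amp`. [cite: Zudilin2002, §4 Lemma 3] -/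
theorem norm_amp_le {κ : ℂ} (hx : 22 ≤ κ.re) (hx' : κ.re ≤ 25) (hu : 0 < κ.im) :
    ‖amp κ‖ ≤ 17 * (Real.log (180 + 2 * κ.im) + π) +
      |1 / 2 * ∑ u ∈ Icc (1 : ℕ) 10, Real.log (2 * Real.pi * (13 + 2 * (u : ℝ))) -
        3 * Real.log (54 * Real.pi)| := by
  set B := Real.log (180 + 2 * κ.im) + π with hB
  set C₂ : ℝ := 1 / 2 * ∑ u ∈ Icc (1 : ℕ) 10, Real.log (2 * Real.pi * (13 + 2 * (u : ℝ))) -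
        3 * Real.log (54 * Real.pi) with hC₂
  have hL : ∀ a : ℝ, -27 ≤ a → a ≤ 64 → 1 ≤ |κ.re + a| → ‖log (κ + a)‖ ≤ B :=
    fun a ha ha' hra ↦ norm_log_add_le hx hx' hu ha ha' hra
  have h0 : ‖log κ‖ ≤ B := by
    simpa using hL 0 (by norm_num) (by norm_num) (by rw [abs_of_pos (by linarith)]; linarith)
  have h27 : ‖log (κ - 27)‖ ≤ B := by
    have := hL (-27) (by norm_num) (by norm_num)
      (by rw [abs_of_neg (by linarith)]; linarith)
    simpa [sub_eq_add_neg] using this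
  have h64 : ‖log (κ + 64)‖ ≤ B := by
    simpa using hL 64 (by norm_num) (by norm_num) (by rw [abs_of_pos (by linarith)]; linarith)
  have h37 : ‖log (κ + 37)‖ ≤ B := by
    simpa using hL 37 (by norm_num) (by norm_num) (by rw [abs_of_pos (by linarith)]; linarith)
  -- the factor `37 + 2κ`: `1 ≤ ‖37 + 2κ‖ ≤ 180 + 2 im κ`
  have hw : ‖log (37 + 2 * κ)‖ ≤ B := by
    refine norm_log_le_of_norm_le ?_ ?_
    · have := abs_re_le_norm (37 + 2 * κ)
      simp only [add_re, re_ofNat, mul_re, im_ofNat, zero_mul, sub_zero] at this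
      rw [abs_of_pos (by linarith)] at this
      linarith
    · refine (norm_le_abs_re_add_abs_im _).trans ?_
      simp only [add_re, re_ofNat, mul_re, im_ofNat, zero_mul, sub_zero, add_im, im_ofNat,
        mul_im, zero_add, add_zero]
      rw [abs_of_pos (by linarith), abs_of_pos (by linarith)]
      linarith
  have hsum : ‖∑ u ∈ Icc (1 : ℕ) 10, (log (κ + 12 - (u : ℂ)) + log (κ + 25 + (u : ℂ)))‖ ≤ 10 * (2 * B) := by
    refine (norm_sum_le _ _).trans ?_
    have : ∀ u ∈ Icc (1 : ℕ) 10, ‖log (κ + 12 - (u : ℂ)) + log (κ + 25 + (u : ℂ))‖ ≤ 2 * B := by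
      intro u hu'
      rw [mem_Icc] at hu'
      have hu1 : (1 : ℝ) ≤ u := by exact_mod_cast hu'.1
      have hu2 : (u : ℝ) ≤ 10 := by exact_mod_cast hu'.2
      have e1 : κ + 25 + (u : ℂ) = κ + ((25 + u : ℝ) : ℂ) := by push_cast; ring
      have e2 : κ + 12 - (u : ℂ) = κ + ((12 - u : ℝ) : ℂ) := by push_cast; ring
      have i1 := hL (25 + u) (by linarith) (by linarith) (by rw [abs_of_pos (by linarith)]; linarith)
      have i2 := hL (12 - u) (by linarith) (by linarith) (by rw [abs_of_pos (by linarith)]; linarith)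
      rw [e1, e2]
      exact (norm_add_le _ _).trans (by linarith)
    refine (sum_le_sum this).trans ?_
    simp
  have e32 : ∀ z : ℂ, ‖(3 / 2 : ℂ) * z‖ = 3 / 2 * ‖z‖ := fun z ↦ by
    rw [norm_mul, norm_div, Complex.norm_ofNat, Complex.norm_ofNat]
  have e12 : ∀ z : ℂ, ‖(1 / 2 : ℂ) * z‖ = 1 / 2 * ‖z‖ := fun z ↦ by
    rw [norm_mul, norm_div, Complex.norm_ofNat, norm_one]
  have hc : ‖((C₂ : ℝ) : ℂ)‖ = |C₂| := by rw [Complex.norm_real, Real.norm_eq_abs]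
  unfold amp
  rw [← hC₂]
  calc _ ≤ ‖log (37 + 2 * κ)‖ + ‖(3 / 2 : ℂ) * (log (κ - 27) - log κ)‖ +
        ‖(3 / 2 : ℂ) * (log (κ + 64) - log (κ + 37))‖ +
        ‖(1 / 2 : ℂ) * ∑ u ∈ Icc (1 : ℕ) 10, (log (κ + 12 - (u : ℂ)) + log (κ + 25 + (u : ℂ)))‖ +
        ‖((C₂ : ℝ) : ℂ)‖ := by
          refine (norm_add_le _ _).trans (add_le_add ?_ le_rfl)
          refine (norm_sub_le _ _).trans (add_le_add ?_ le_rfl)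
          refine (norm_add_le _ _).trans (add_le_add ?_ le_rfl)
          exact norm_add_le _ _
    _ ≤ B + 3 / 2 * (B + B) + 3 / 2 * (B + B) + 1 / 2 * (10 * (2 * B)) + |C₂| := by
          rw [e32, e32, e12, hc]
          gcongr
          · exact (norm_sub_le _ _).trans (add_le_add h27 h0)
          · exact (norm_sub_le _ _).trans (add_le_add h64 h37)
    _ = 17 * B + |C₂| := by ring

/-- **`Re ψ(κ) ≤ C₁ + 162 log (180 + 2 |im κ|)`** on the strip `22 ≤ re κ ≤ 25`, `im κ ≠ 0`
(`C₁` the real constant of `Zudilin2004.psiR`): the two numerator blocks contribute at most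
`81 log (180 + 2|im κ|)` each and the denominator blocks are nonnegative.
[cite: Zudilin2004, §8 Lemma 20] -/
theorem re_psiR_le {κ : ℂ} (hx : 22 ≤ κ.re) (hx' : κ.re ≤ 25) (hu : κ.im ≠ 0) :
    (psiR κ).re ≤ (∑ u ∈ Icc (1 : ℕ) 10, ((13 + 2 * (u : ℝ)) * Real.log (13 + 2 * (u : ℝ)) -
        (13 + 2 * (u : ℝ))) - 6 * (27 * Real.log 27 - 27)) + 162 * Real.log (180 + 2 * |κ.im|) := by
  set M := Real.log (180 + 2 * |κ.im|) with hM
  -- `Re blockInt = ∫ log ‖κ + x‖`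
  have hblock : ∀ a b : ℝ, (blockInt κ a b).re = ∫ x in a..b, Real.log ‖κ + x‖ := fun a b ↦ by
    rw [Literature.Analysis.SpecialFunctions.integral_log_norm_add_eq hu]; rfl
  -- pointwise bounds for the integrand
  have hup : ∀ x : ℝ, -27 ≤ x → x ≤ 64 → Real.log ‖κ + x‖ ≤ M := by
    intro x h1 h2
    by_cases h0 : ‖κ + x‖ = 0
    · rw [h0, Real.log_zero]; exact Real.log_nonneg (by linarith [abs_nonneg κ.im])
    refine Real.log_le_log (lt_of_le_of_ne (norm_nonneg _) (Ne.symm h0)) ?_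
    refine (norm_le_abs_re_add_abs_im _).trans ?_
    simp only [add_re, ofReal_re, add_im, ofReal_im, add_zero]
    have : |κ.re + x| ≤ 89 := by rw [abs_le]; constructor <;> linarith
    linarith [abs_nonneg κ.im]
  have hlow : ∀ x : ℝ, 2 ≤ x → 0 ≤ Real.log ‖κ + x‖ := by
    intro x h2
    refine Real.log_nonneg ?_
    have := abs_re_le_norm (κ + x)
    simp only [add_re, ofReal_re] at this
    rw [abs_of_pos (by linarith)] at this
    linarith
  have hcont : Continuous fun x : ℝ ↦ Real.log ‖κ + x‖ :=
    Continuous.log (by fun_prop) fun x ↦ (norm_pos_iff.2 fun h0 ↦ hu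
      (by simpa using congrArg Complex.im h0)).ne'
  have hI1 : (blockInt κ (-27) 0).re ≤ 27 * M := by
    rw [hblock]
    have := intervalIntegral.integral_mono_on (by norm_num) (hcont.intervalIntegrable (-27) 0)
      (intervalIntegrable_const (μ := MeasureTheory.volume))
      (fun x hx ↦ hup x hx.1 (by linarith [hx.2]) : ∀ x ∈ Set.Icc (-27 : ℝ) 0, Real.log ‖κ + x‖ ≤ M)
    rw [intervalIntegral.integral_const, smul_eq_mul] at this; linarith
  have hI2 : (blockInt κ 37 64).re ≤ 27 * M := by
    rw [hblock]
    have := intervalIntegral.integral_mono_on (by norm_num) (hcont.intervalIntegrable 37 64)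
      (intervalIntegrable_const (μ := MeasureTheory.volume))
      (fun x hx ↦ hup x (by linarith [hx.1]) hx.2 : ∀ x ∈ Set.Icc (37 : ℝ) 64, Real.log ‖κ + x‖ ≤ M)
    rw [intervalIntegral.integral_const, smul_eq_mul] at this; linarith
  have hI3 : ∀ u ∈ Icc (1 : ℕ) 10, 0 ≤ (blockInt κ (12 - (u : ℝ)) (25 + (u : ℝ))).re := by
    intro u hu'
    rw [mem_Icc] at hu'
    have hu2 : (u : ℝ) ≤ 10 := by exact_mod_cast hu'.2
    rw [hblock]
    refine intervalIntegral.integral_nonneg (by linarith) fun x hx ↦ hlow x (by linarith [hx.1])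
  have hsum : 0 ≤ (∑ u ∈ Icc (1 : ℕ) 10, blockInt κ (12 - (u : ℝ)) (25 + (u : ℝ))).re := by
    rw [Complex.re_sum]; exact sum_nonneg hI3
  unfold psiR
  simp only [add_re, sub_re, mul_re, re_ofNat, im_ofNat, zero_mul, sub_zero, ofReal_re]
  linarith

/-- **Horizontal Lipschitz bound**: for `u > 0` and `x, x' ∈ [22, 25]`,
`‖Φ(x' + iu) − Φ(x + iu)‖ ≤ (32 (log (180 + 2u) + π) + 2π) · |x' − x|`. [cite: Zudilin2004, §8 Lemma 20] -/
theorem norm_phase_sub_phase_le {x x' u : ℝ} (hu : 0 < u) (hx : 22 ≤ x) (hx2 : x ≤ 25)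
    (hx' : 22 ≤ x') (hx2' : x' ≤ 25) :
    ‖phase ((x' : ℂ) + u * I) - phase ((x : ℂ) + u * I)‖ ≤
      (32 * (Real.log (180 + 2 * u) + π) + 2 * π) * |x' - x| := by
  set g : ℝ → ℂ := fun t ↦ phase ((t : ℂ) + u * I) with hg
  have him : ∀ t : ℝ, ((t : ℂ) + u * I).im = u := fun t ↦ by simp
  have hre : ∀ t : ℝ, ((t : ℂ) + u * I).re = t := fun t ↦ by simp
  have hderiv : ∀ t ∈ Set.Icc (22 : ℝ) 25,
      HasDerivWithinAt g (dphase ((t : ℂ) + u * I)) (Set.Icc 22 25) t := by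
    intro t _
    have h1 : HasDerivAt (fun z : ℂ ↦ phase (z + u * I)) (dphase ((t : ℂ) + u * I)) (t : ℂ) :=
      HasDerivAt.comp_add_const (t : ℂ) (u * I) (hasDerivAt_phase (by rw [him]; exact hu))
    exact h1.comp_ofReal.hasDerivWithinAt
  have hbound : ∀ t ∈ Set.Icc (22 : ℝ) 25,
      ‖dphase ((t : ℂ) + u * I)‖ ≤ 32 * (Real.log (180 + 2 * u) + π) + 2 * π := by
    intro t ht
    have := norm_dphase_le (κ := (t : ℂ) + u * I) (by rw [hre]; exact ht.1)
      (by rw [hre]; exact ht.2) (by rw [him]; exact hu)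
    rwa [him] at this
  have := (convex_Icc (22 : ℝ) 25).norm_image_sub_le_of_norm_hasDerivWithin_le hderiv hbound
    ⟨hx, hx2⟩ ⟨hx', hx2'⟩
  rwa [Real.norm_eq_abs] at this

/-! ### Continuity of `Φ'` and `A` on the upper half-plane -/

/-- `Φ'` is continuous on the open upper half-plane. [folklore] -/
theorem continuousOn_dphase : ContinuousOn dphase {κ : ℂ | 0 < κ.im} := by
  have hlog : ∀ a : ℝ, ContinuousOn (fun κ : ℂ ↦ log (κ + a)) {κ : ℂ | 0 < κ.im} := fun a ↦
    ContinuousOn.clog (by fun_prop) fun κ hκ ↦ add_real_mem_slitPlane hκ a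
  have h0 : ContinuousOn (fun κ : ℂ ↦ log κ) {κ : ℂ | 0 < κ.im} := by simpa using hlog 0
  have h27 : ContinuousOn (fun κ : ℂ ↦ log (κ - 27)) {κ : ℂ | 0 < κ.im} := by
    have := hlog (-27); push_cast at this; simpa [sub_eq_add_neg] using this
  have h64 : ContinuousOn (fun κ : ℂ ↦ log (κ + 64)) {κ : ℂ | 0 < κ.im} := by
    simpa using hlog 64
  have h37 : ContinuousOn (fun κ : ℂ ↦ log (κ + 37)) {κ : ℂ | 0 < κ.im} := by
    simpa using hlog 37
  have hs : ContinuousOn (fun κ : ℂ ↦ ∑ u ∈ Icc (1 : ℕ) 10,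
      (log (κ + 25 + (u : ℂ)) - log (κ + 12 - (u : ℂ)))) {κ : ℂ | 0 < κ.im} := by
    refine continuousOn_finsetSum _ fun u _ ↦ ?_
    have e1 : ∀ κ : ℂ, κ + 25 + (u : ℂ) = κ + ((25 + u : ℝ) : ℂ) := fun κ ↦ by push_cast; ring
    have e2 : ∀ κ : ℂ, κ + 12 - (u : ℂ) = κ + ((12 - u : ℝ) : ℂ) := fun κ ↦ by push_cast; ring
    simp_rw [e1, e2]
    exact (hlog _).sub (hlog _)
  unfold dphase
  exact (((((continuousOn_const.mul h0).sub (continuousOn_const.mul h27)).add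
    (continuousOn_const.mul h64)).sub (continuousOn_const.mul h37)).sub hs).add continuousOn_const

/-- `A` is continuous on the open upper half-plane. [folklore] -/
theorem continuousOn_amp : ContinuousOn amp {κ : ℂ | 0 < κ.im} := by
  have hlog : ∀ a : ℝ, ContinuousOn (fun κ : ℂ ↦ log (κ + a)) {κ : ℂ | 0 < κ.im} := fun a ↦
    ContinuousOn.clog (by fun_prop) fun κ hκ ↦ add_real_mem_slitPlane hκ a
  have h0 : ContinuousOn (fun κ : ℂ ↦ log κ) {κ : ℂ | 0 < κ.im} := by simpa using hlog 0
  have h27 : ContinuousOn (fun κ : ℂ ↦ log (κ - 27)) {κ : ℂ | 0 < κ.im} := by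
    have := hlog (-27); push_cast at this; simpa [sub_eq_add_neg] using this
  have h64 : ContinuousOn (fun κ : ℂ ↦ log (κ + 64)) {κ : ℂ | 0 < κ.im} := by
    simpa using hlog 64
  have h37 : ContinuousOn (fun κ : ℂ ↦ log (κ + 37)) {κ : ℂ | 0 < κ.im} := by
    simpa using hlog 37
  have hw : ContinuousOn (fun κ : ℂ ↦ log (37 + 2 * κ)) {κ : ℂ | 0 < κ.im} :=
    ContinuousOn.clog (by fun_prop) fun κ (hκ : 0 < κ.im) ↦ Or.inr (by simp [hκ.ne'])
  have hs : ContinuousOn (fun κ : ℂ ↦ ∑ u ∈ Icc (1 : ℕ) 10,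
      (log (κ + 12 - (u : ℂ)) + log (κ + 25 + (u : ℂ)))) {κ : ℂ | 0 < κ.im} := by
    refine continuousOn_finsetSum _ fun u _ ↦ ?_
    have e1 : ∀ κ : ℂ, κ + 25 + (u : ℂ) = κ + ((25 + u : ℝ) : ℂ) := fun κ ↦ by push_cast; ring
    have e2 : ∀ κ : ℂ, κ + 12 - (u : ℂ) = κ + ((12 - u : ℝ) : ℂ) := fun κ ↦ by push_cast; ring
    simp_rw [e1, e2]
    exact (hlog _).add (hlog _)
  unfold amp
  exact (((hw.add (continuousOn_const.mul (h27.sub h0))).add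
    (continuousOn_const.mul (h64.sub h37))).sub (continuousOn_const.mul hs)).add continuousOn_const

/-! ### The exponentiated saddle-point equation -/

/-- **`exp Φ'(κ) = κ³(κ+64)³ ∏_u (κ+12−u) / ((κ−27)³ (κ+37)³ ∏_u (κ+25+u))`** for `im κ > 0`:
the zeros of `Φ'` solve the polynomial equation of [Zudilin2004, Lemma 20].
[cite: Zudilin2004, §8 Lemma 20] -/
theorem exp_dphase {κ : ℂ} (hκ : 0 < κ.im) :
    exp (dphase κ) = κ ^ 3 * (κ + 64) ^ 3 * (∏ u ∈ Icc (1 : ℕ) 10, (κ + 12 - (u : ℂ))) /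
      ((κ - 27) ^ 3 * (κ + 37) ^ 3 * ∏ u ∈ Icc (1 : ℕ) 10, (κ + 25 + (u : ℂ))) := by
  have hz0 : ∀ z : ℂ, z.im ≠ 0 → z ≠ 0 := fun z hz h ↦ hz (by simp [h])
  have hz : ∀ z : ℂ, z.im ≠ 0 → exp (log z) = z := fun z h ↦ Complex.exp_log (hz0 z h)
  have hz3 : ∀ z : ℂ, z.im ≠ 0 → exp (3 * log z) = z ^ 3 := fun z h ↦ by
    rw [show (3 : ℂ) * log z = ((3 : ℕ) : ℂ) * log z by push_cast; rfl, Complex.exp_nat_mul, hz z h]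
  have i0 : κ.im ≠ 0 := hκ.ne'
  have i27 : (κ - 27).im ≠ 0 := by simpa using i0
  have i64 : (κ + 64).im ≠ 0 := by simpa using i0
  have i37 : (κ + 37).im ≠ 0 := by simpa using i0
  have i25 : ∀ u : ℕ, (κ + 25 + (u : ℂ)).im ≠ 0 := fun u ↦ by simpa using i0
  have i12 : ∀ u : ℕ, (κ + 12 - (u : ℂ)).im ≠ 0 := fun u ↦ by simpa using i0
  have h2pi : exp (2 * Real.pi * I) = 1 := Complex.exp_two_pi_mul_I
  unfold dphase
  rw [Complex.exp_add, h2pi, mul_one]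
  simp only [Complex.exp_sub, Complex.exp_add, Complex.exp_sum, hz3 κ i0, hz3 _ i27, hz3 _ i64,
    hz3 _ i37]
  rw [prod_congr rfl (fun u _ ↦ by rw [hz _ (i25 u), hz _ (i12 u)] :
    ∀ u ∈ Icc (1 : ℕ) 10, exp (log (κ + 25 + (u : ℂ))) / exp (log (κ + 12 - (u : ℂ))) =
      (κ + 25 + (u : ℂ)) / (κ + 12 - (u : ℂ))), prod_div_distrib]
  have d27 : (κ - 27) ^ 3 ≠ 0 := pow_ne_zero 3 (hz0 _ i27)
  have d37 : (κ + 37) ^ 3 ≠ 0 := pow_ne_zero 3 (hz0 _ i37)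
  have d25 : ∏ u ∈ Icc (1 : ℕ) 10, (κ + 25 + (u : ℂ)) ≠ 0 :=
    prod_ne_zero_iff.2 fun u _ ↦ hz0 _ (i25 u)
  have d12 : ∏ u ∈ Icc (1 : ℕ) 10, (κ + 12 - (u : ℂ)) ≠ 0 :=
    prod_ne_zero_iff.2 fun u _ ↦ hz0 _ (i12 u)
  field_simp

end Zudilin2004

/-! ### The kernel `sinh y / cosh³ y` -/

/-- `sinh y / cosh³ y = 4 e^{−2y} (1 − e^{−2y}) / (1 + e^{−2y})³`. [folklore] -/
theorem sinh_div_cosh_cube_eq (y : ℝ) :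
    Real.sinh y / Real.cosh y ^ 3 =
      4 * Real.exp (-2 * y) * (1 - Real.exp (-2 * y)) / (1 + Real.exp (-2 * y)) ^ 3 := by
  have h1 : Real.exp (-2 * y) = Real.exp (-y) * Real.exp (-y) := by
    rw [← Real.exp_add]; ring_nf
  have hc : Real.cosh y ≠ 0 := (Real.cosh_pos y).ne'
  rw [Real.sinh_eq, Real.cosh_eq] at *
  have hpos : 0 < Real.exp y := Real.exp_pos y
  have hinv : Real.exp (-y) = (Real.exp y)⁻¹ := Real.exp_neg y
  rw [h1, hinv]
  have h2 : (Real.exp y + (Real.exp y)⁻¹) / 2 ≠ 0 := by positivity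
  field_simp
  ring

/-- `sinh y / cosh³ y ≤ 4 e^{−2y}` for `y ≥ 0`. [folklore] -/
theorem sinh_div_cosh_cube_le {y : ℝ} (hy : 0 ≤ y) :
    Real.sinh y / Real.cosh y ^ 3 ≤ 4 * Real.exp (-2 * y) := by
  rw [sinh_div_cosh_cube_eq]
  have hq0 : 0 < Real.exp (-2 * y) := Real.exp_pos _
  have hq1 : Real.exp (-2 * y) ≤ 1 := by rw [Real.exp_le_one_iff]; linarith
  rw [div_le_iff₀ (by positivity)]
  have : 1 ≤ (1 + Real.exp (-2 * y)) ^ 3 := one_le_pow₀ (by linarith)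
  nlinarith [mul_nonneg (mul_nonneg (by norm_num : (0:ℝ) ≤ 4) hq0.le) hq0.le]

/-- `0 ≤ sinh y / cosh³ y` for `y ≥ 0`. [folklore] -/
theorem sinh_div_cosh_cube_nonneg {y : ℝ} (hy : 0 ≤ y) : 0 ≤ Real.sinh y / Real.cosh y ^ 3 :=
  div_nonneg (Real.sinh_nonneg_iff.2 hy) (pow_nonneg (Real.cosh_pos y).le 3)

/-- `e^{2y} sinh y / cosh³ y → 4` as `y → +∞`. [folklore] -/
theorem tendsto_sinh_div_cosh_cube_mul_exp :
    Tendsto (fun y : ℝ ↦ Real.sinh y / Real.cosh y ^ 3 * Real.exp (2 * y)) atTop (𝓝 4) := by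
  have hq : Tendsto (fun y : ℝ ↦ Real.exp (-2 * y)) atTop (𝓝 0) := by
    have h1 : Tendsto (fun y : ℝ ↦ 2 * y) atTop atTop := tendsto_id.const_mul_atTop two_pos
    refine (Real.tendsto_exp_neg_atTop_nhds_zero.comp h1).congr fun y ↦ ?_
    simp only [Function.comp_apply, neg_mul]
  have hlim : Tendsto (fun y : ℝ ↦ 4 * (1 - Real.exp (-2 * y)) / (1 + Real.exp (-2 * y)) ^ 3)
      atTop (𝓝 4) := by
    have := ((hq.const_sub 1).const_mul 4).div ((hq.const_add 1).pow 3) (by norm_num)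
    simpa [Pi.div_def] using this
  refine hlim.congr fun y ↦ ?_
  rw [sinh_div_cosh_cube_eq]
  have h1 : Real.exp (-2 * y) * Real.exp (2 * y) = 1 := by
    rw [← Real.exp_add]; ring_nf; exact Real.exp_zero
  rw [show 4 * Real.exp (-2 * y) * (1 - Real.exp (-2 * y)) / (1 + Real.exp (-2 * y)) ^ 3 *
      Real.exp (2 * y) = 4 * (Real.exp (-2 * y) * Real.exp (2 * y)) * (1 - Real.exp (-2 * y)) /
      (1 + Real.exp (-2 * y)) ^ 3 by ring, h1, mul_one]

end Literature.NumberTheory.Transcendental
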